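import Literature.NumberTheory.PAdicHodge.CompletedAlgClosure
import Mathlib.FieldTheory.Minpoly.IsConjRoot
import Mathlib.Algebra.Polynomial.HasseDeriv
import Mathlib.Algebra.Polynomial.Taylor
import Mathlib.Algebra.Polynomial.Splits
import Mathlib.Data.Nat.Choose.Factorization
import Mathlib.Analysis.Normed.Field.Ultra
import Mathlib.Analysis.SpecialFunctions.Pow.Real
import Mathlib.Analysis.SpecificLimits.Normed
import HarnessLib

/-!
# Ax's lemma and the Ax–Sen–Tate theorem `ℂ_F^{Γ_F} = F`

Let `F` be a non-archimedean local field of characteristic `0` and residue characteristic `p`,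
`F̄ = NormedAlgClosure F` its algebraic closure with the absolute value `‖·‖` extending that of
`F`, `Γ_F = Gal(F̄/F)` (acting by isometries), and `ℂ_F = CompletedAlgClosure F` the completion
of `F̄` with its action of `Γ_F` by isometric ring automorphisms
(`Literature/NumberTheory/PAdicHodge/CompletedAlgClosure`). This file proves:

* `NormedAlgClosure.ax_lemma` — **Ax's lemma** (Ax 1970; Fontaine–Ouyang §3.1 "Ax–Sen's
  lemma"): if `α ∈ F̄` satisfies `‖σ α - α‖ ≤ D` for all `σ ∈ Γ_F`, then there is `a ∈ F` with
  `‖α - a‖ ≤ ‖p‖^{-c} · D`, where `c = c_p(k) = Σ_{i=1}^{k} i / p^{i-1}`, `p^k ≤ deg_F α < p^{k+1}`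
  (`axExponent`), and uniformly `c ≤ (p/(p-1))²` (`ax_lemma'`). Ax proves the sharper constant
  `p/(p-1)²` (in additive notation `v(α - a) ≥ Δ(α) - (p/(p-1)²) v(p)`); we prove the weaker
  constant because it follows from the crude Kummer bound `v_p (n choose j) ≤ log_p n`
  (Mathlib `Nat.factorization_choose_le_log`) alone, and any uniform constant gives the theorem
  below. PROOF (Ax's method): induction on the band `k = log_p (deg α)`; for `deg α = n ≥ 2` and
  `m := p^{k-1}` (`m := 1` if `n < p`) the Hasse derivative `g = ∂^{(n-m)} f` of the minimal
  polynomial `f` of `α` has degree `m` and leading coefficient `(n choose m)`; expanding `f` at `α`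
  (`taylor`), the constant coefficient of `g(α + Y)` is the `(n-m)`-th coefficient of
  `∏_{α'} (Y - (α' - α))` over the conjugates `α' = σ α`, of norm `≤ D^m` by the ultrametric
  inequality; hence (`F̄` algebraically closed) `g` has a root `β` with
  `‖β - α‖^m · ‖(n choose m)‖ ≤ D^m`, i.e. `‖β - α‖ ≤ D ‖p‖^{-k/m}`; `β` has degree `≤ m` over `F`
  and `‖τ β - β‖ ≤ D ‖p‖^{-k/m}` for all `τ`, and the induction hypothesis applies to `β`.
* `CompletedAlgClosure.fixedPoints_eq_range_algebraMap` — **the Ax–Sen–Tate theorem**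
  (Tate 1967, §3.3 Thm. 1; Ax 1970, main Theorem; Fontaine–Ouyang §3.1 (`C^{G_K} = K`)):
  `{x ∈ ℂ_F | σ x = x for all σ ∈ Γ_F} = F`. PROOF: approximate a fixed `x` by `α ∈ F̄`; then
  `‖σ α - α‖ ≤ ‖x - α‖` (isometry), Ax's lemma gives `a ∈ F` with `‖α - a‖ ≤ M ‖x - α‖`, so `x`
  is in the closure of `F`, which is closed (complete). This is the degree-`0` part of the
  computation `B_HT^{Γ_F} = B_dR^{Γ_F} = F` (`PeriodRingData.invariants_eq` for Fontaine's period
  rings); the parts of nonzero Hodge–Tate degree (Tate: `ℂ_F(i)^{Γ_F} = 0`, `i ≠ 0`) are not here.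

Characteristic `0` is needed: for `F = 𝔽_q((t))` the fixed field of `Γ_F` in `ℂ_F` is the
completion of the perfect closure of `F`, and `‖p‖ = 0`.

## References

* J. Ax, *Zeros of polynomials over local fields — the Galois action*, J. Algebra 15 (1970),
  417–428 (the lemma with constant `p/(p-1)²`, and `\hat{K̄}^{G} = K`). [Ax1970]
* J. Tate, *p-divisible groups*, Proc. Conf. Local Fields (Driebergen 1966), Springer 1967, §3.3,
  Theorem 1 (`H⁰(G, C) = K`). [Tate1967]
* J.-M. Fontaine, Y. Ouyang, *Theory of p-adic Galois representations*, §3.1 (Ax–Sen's lemma;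
  `C^{G_K} = K`). [FontaineOuyang2022]
-/

noncomputable section

open ValuativeRel Field UniformSpace Polynomial

namespace Literature.NumberTheory.PAdicHodge

open Literature.NumberTheory.GaloisRepresentations
open Literature.NumberTheory.GaloisRepresentations.IsNonarchimedeanLocalField

/-! ### Elementary estimates over a normed field -/

section General

variable {L : Type*} [NormedField L]

/-- Ultrametric inequality for differences: `‖x - y‖ ≤ max ‖x‖ ‖y‖`. [folklore] -/
theorem norm_sub_le_max' [IsUltrametricDist L] (x y : L) : ‖x - y‖ ≤ max ‖x‖ ‖y‖ := by
  rw [sub_eq_add_neg, ← norm_neg y]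
  exact IsUltrametricDist.norm_add_le_max x (-y)

/-- In a normed field, a product of elements of norm `≥ c ≥ 0` has norm `≥ c ^ (number of factors)`.
[folklore] -/
theorem pow_card_le_norm_multiset_prod (s : Multiset L) {c : ℝ} (hc : 0 ≤ c)
    (hs : ∀ r ∈ s, c ≤ ‖r‖) : c ^ (Multiset.card s) ≤ ‖s.prod‖ := by
  induction s using Multiset.induction_on with
  | empty => simp
  | cons a s ih =>
    rw [Multiset.card_cons, pow_succ, Multiset.prod_cons, norm_mul, mul_comm]
    exact mul_le_mul (hs a (Multiset.mem_cons_self a s))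
      (ih fun r hr => hs r (Multiset.mem_cons_of_mem hr)) (pow_nonneg hc _) (norm_nonneg _)

/-- **Small root**: over an algebraically closed normed field, a polynomial `q` of degree
`d ≥ 1` has a root `γ` with `‖γ‖ ^ d · ‖lead q‖ ≤ ‖q(0)‖` (the root of smallest absolute value;
product of the roots `= ± q(0) / lead q`). [folklore] -/
theorem exists_isRoot_norm_pow_mul_le [IsAlgClosed L] (q : L[X]) (hq : q.natDegree ≠ 0) :
    ∃ γ : L, q.IsRoot γ ∧ ‖γ‖ ^ q.natDegree * ‖q.leadingCoeff‖ ≤ ‖q.coeff 0‖ := by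
  classical
  have hspl : q.Splits := IsAlgClosed.splits q
  have hroots : q.roots ≠ 0 := hspl.roots_ne_zero hq
  obtain ⟨γ, hγ, hmin⟩ := q.roots.toFinset.exists_min_image (fun r => ‖r‖)
    (Multiset.toFinset_nonempty.mpr hroots)
  have hq0 : q ≠ 0 := fun h => hq (by rw [h, natDegree_zero])
  refine ⟨γ, (mem_roots hq0).mp (Multiset.mem_toFinset.mp hγ), ?_⟩
  rw [hspl.coeff_zero_eq_leadingCoeff_mul_prod_roots, norm_mul, norm_mul, norm_pow, norm_neg,
    norm_one, one_pow, one_mul, mul_comm, hspl.natDegree_eq_card_roots]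
  exact mul_le_mul_of_nonneg_left
    (pow_card_le_norm_multiset_prod q.roots (norm_nonneg γ)
      fun r hr => hmin r (Multiset.mem_toFinset.mpr hr)) (norm_nonneg _)

/-- **Ultrametric bound for the elementary symmetric functions**: if `‖δ‖ ≤ D` for all `δ ∈ s`
then the `m`-th coefficient of `∏_{δ ∈ s} (X - δ)` has norm `≤ D ^ (|s| - m)`. [folklore] -/
theorem norm_coeff_prod_X_sub_C_le [IsUltrametricDist L] (s : Multiset L) {D : ℝ} (hD : 0 ≤ D)
    (hs : ∀ δ ∈ s, ‖δ‖ ≤ D) :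
    ∀ m : ℕ, ‖((s.map fun δ => X - C δ).prod).coeff m‖ ≤ D ^ (Multiset.card s - m) := by
  induction s using Multiset.induction_on with
  | empty =>
    intro m
    simp only [Multiset.map_zero, Multiset.prod_zero, Multiset.card_zero, Nat.zero_sub, pow_zero,
      coeff_one]
    split_ifs <;> simp
  | cons a s ih =>
    intro m
    have ha : ‖a‖ ≤ D := hs a (Multiset.mem_cons_self a s)
    have ih' := ih fun δ hδ => hs δ (Multiset.mem_cons_of_mem hδ)
    set q : L[X] := (s.map fun δ => X - C δ).prod with hq
    have hdeg : q.natDegree = Multiset.card s := by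
      rw [hq, natDegree_multiset_prod_X_sub_C_eq_card]
    have hzero : ∀ n, Multiset.card s < n → q.coeff n = 0 := fun n hn =>
      coeff_eq_zero_of_natDegree_lt (hdeg ▸ hn)
    rw [Multiset.map_cons, Multiset.prod_cons, Multiset.card_cons, ← hq, sub_mul, coeff_sub,
      coeff_C_mul]
    cases m with
    | zero =>
      rw [coeff_X_mul_zero, zero_sub, norm_neg, norm_mul, Nat.sub_zero, pow_succ, mul_comm]
      exact mul_le_mul (ih' 0 |>.trans (by rw [Nat.sub_zero])) ha (norm_nonneg _)
        (pow_nonneg hD _)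
    | succ m =>
      rw [coeff_X_mul, Nat.succ_sub_succ]
      refine (norm_sub_le_max' _ _).trans (max_le ?_ ?_)
      · exact ih' m
      · rw [norm_mul]
        rcases Nat.lt_or_ge (Multiset.card s) (m + 1) with hlt | hle
        · rw [hzero _ hlt, norm_zero, mul_zero]
          exact pow_nonneg hD _
        · calc ‖a‖ * ‖q.coeff (m + 1)‖ ≤ D * D ^ (Multiset.card s - (m + 1)) :=
              mul_le_mul ha (ih' (m + 1)) (norm_nonneg _) hD
            _ = D ^ (Multiset.card s - m) := by
              rw [← pow_succ']
              congr 1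
              omega

/-- `hasseDeriv` commutes with `map`. [folklore] -/
theorem hasseDeriv_map {R S : Type*} [CommSemiring R] [CommSemiring S] (φ : R →+* S) (k : ℕ)
    (f : R[X]) : hasseDeriv k (f.map φ) = (hasseDeriv k f).map φ := by
  ext n
  simp only [hasseDeriv_coeff, coeff_map, map_mul, map_natCast]

/-- In an ultrametric normed field in which the prime `p` has norm `< 1`, every natural number
prime to `p` has norm `1`. [folklore] -/
theorem norm_natCast_eq_one_of_not_dvd [IsUltrametricDist L] {p : ℕ} (hp : p.Prime)
    (hpL : ‖(p : L)‖ < 1) {u : ℕ} (hu : ¬p ∣ u) : ‖(u : L)‖ = 1 := by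
  have hcop : Nat.Coprime p u := (Nat.Prime.coprime_iff_not_dvd hp).mpr hu
  refine le_antisymm (IsUltrametricDist.norm_natCast_le_one L u) ?_
  by_contra hlt
  rw [not_le] at hlt
  have hbez := Nat.gcd_eq_gcd_ab p u
  rw [Nat.Coprime.gcd_eq_one hcop, Nat.cast_one] at hbez
  have h1 : (1 : L) = (p : L) * (Nat.gcdA p u : ℤ) + (u : L) * (Nat.gcdB p u : ℤ) := by
    have := congrArg (fun z : ℤ => (z : L)) hbez
    push_cast at this
    exact this
  have hlt1 : ‖(1 : L)‖ < 1 := by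
    rw [h1]
    refine (IsUltrametricDist.norm_add_le_max _ _).trans_lt (max_lt ?_ ?_)
    · rw [norm_mul]
      exact mul_lt_one_of_nonneg_of_lt_one_left (norm_nonneg _) hpL
        (IsUltrametricDist.norm_intCast_le_one L _)
    · rw [norm_mul]
      exact mul_lt_one_of_nonneg_of_lt_one_left (norm_nonneg _) hlt
        (IsUltrametricDist.norm_intCast_le_one L _)
  rw [norm_one] at hlt1
  exact lt_irrefl _ hlt1

/-- In an ultrametric normed field in which the prime `p` has norm `< 1`: if `p^k ∤ N / p`-wise,
precisely if `v_p(N) ≤ k` and `N ≠ 0`, then `‖p‖ ^ k ≤ ‖N‖`. [folklore] -/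
theorem norm_prime_pow_le_norm_natCast [IsUltrametricDist L] {p : ℕ} (hp : p.Prime)
    (hpL : ‖(p : L)‖ < 1) {N k : ℕ} (hN : N ≠ 0) (hk : N.factorization p ≤ k) :
    ‖(p : L)‖ ^ k ≤ ‖(N : L)‖ := by
  have hdecomp : p ^ N.factorization p * (N / p ^ N.factorization p) = N :=
    Nat.ordProj_mul_ordCompl_eq_self N p
  have hcop : ¬p ∣ N / p ^ N.factorization p := Nat.not_dvd_ordCompl hp hN
  conv_rhs => rw [← hdecomp]
  rw [Nat.cast_mul, Nat.cast_pow, norm_mul, norm_pow, norm_natCast_eq_one_of_not_dvd hp hpL hcop,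
    mul_one]
  exact pow_le_pow_of_le_one (norm_nonneg _) hpL.le hk

end General

/-! ### Ax's lemma over `F̄` -/

section Ax

variable {F : Type} [Field F] [ValuativeRel F] [TopologicalSpace F] [IsNonarchimedeanLocalField F]

namespace NormedAlgClosure

/-- Every root in `F̄` of the minimal polynomial of `α ∈ F̄` is a Galois conjugate `σ • α`
(`F̄/F` is normal). [folklore] -/
theorem exists_smul_eq_of_mem_aroots (α r : NormedAlgClosure F)
    (hr : r ∈ (minpoly F α).aroots (NormedAlgClosure F)) :
    ∃ σ : absoluteGaloisGroup F, r = σ • α := by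
  have hint : IsIntegral F α := Algebra.IsIntegral.isIntegral α
  have hconj : IsConjRoot F α r := (isConjRoot_iff_mem_minpoly_aroots hint).mpr hr
  obtain ⟨s, hs⟩ := hconj.exists_algEquiv
  obtain ⟨σ, hσ⟩ := exists_smul_eq_of_algEquiv (F := F) s.symm
  refine ⟨σ, ?_⟩
  rw [hσ, ← hs, AlgEquiv.symm_apply_apply]

/-- The Galois-deviation bound passes to nearby elements: if `‖σ α - α‖ ≤ D` for all `σ` and
`‖β - α‖ ≤ D'` with `D ≤ D'`, then `‖τ β - β‖ ≤ D'` for all `τ` (isometry + ultrametric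
inequality). [folklore] -/
theorem norm_smul_sub_le_of_near {α β : NormedAlgClosure F} {D D' : ℝ}
    (hα : ∀ σ : absoluteGaloisGroup F, ‖σ • α - α‖ ≤ D) (hβ : ‖β - α‖ ≤ D') (hDD' : D ≤ D')
    (τ : absoluteGaloisGroup F) : ‖τ • β - β‖ ≤ D' := by
  have h : τ • β - β = τ • (β - α) + ((τ • α - α) + (α - β)) := by
    rw [smul_sub]; abel
  rw [h]
  refine (IsUltrametricDist.norm_add_le_max _ _).trans (max_le ?_ ?_)
  · rw [norm_smul]; exact hβ
  · refine (IsUltrametricDist.norm_add_le_max _ _).trans (max_le ((hα τ).trans hDD') ?_)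
    rw [norm_sub_rev]; exact hβ

/-- `F̄` has characteristic `0` when `F` does. [folklore] -/
instance instCharZero [CharZero F] : CharZero (NormedAlgClosure F) :=
  charZero_of_injective_algebraMap (algebraMap F (NormedAlgClosure F)).injective

variable [CharZero F]

/-- **The step of Ax's induction.** Let `α ∈ F̄` have degree `n` over `F`, `‖σ α - α‖ ≤ D` for
all `σ ∈ Γ_F`, `1 ≤ m < n` and `log_p n ≤ k`, where the prime `p` has `‖p‖ < 1` in `F̄`. Then some
`β ∈ F̄` of degree `≤ m` over `F` (a root of the Hasse derivative `∂^{(n-m)}` of the minimal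
polynomial of `α`) satisfies `‖β - α‖ ≤ D · ‖p‖^{-k/m}` (Ax 1970, proof of the Lemma;
Fontaine–Ouyang §3.1, proof of Ax–Sen's lemma). [cite: Ax1970, the Lemma on Δ(α)] -/
theorem ax_step {p : ℕ} (hp : p.Prime) (hpL : ‖(p : NormedAlgClosure F)‖ < 1)
    (α : NormedAlgClosure F) {D : ℝ} (hD : 0 ≤ D)
    (hα : ∀ σ : absoluteGaloisGroup F, ‖σ • α - α‖ ≤ D) {m : ℕ} (hm : 1 ≤ m)
    (hmn : m < (minpoly F α).natDegree) {k : ℕ} (hk : Nat.log p (minpoly F α).natDegree ≤ k) :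
    ∃ β : NormedAlgClosure F, (minpoly F β).natDegree ≤ m ∧
      ‖β - α‖ ≤ D * ‖(p : NormedAlgClosure F)‖ ^ (-((k : ℝ) / m)) := by
  classical
  have hint : IsIntegral F α := Algebra.IsIntegral.isIntegral α
  set f : F[X] := minpoly F α with hf
  set n : ℕ := f.natDegree with hn
  have hfmonic : f.Monic := minpoly.monic hint
  set j : ℕ := n - m with hj
  have hjn : j ≤ n := Nat.sub_le n m
  have hmj : m + j = n := by omega
  have hnj : n - j = m := by omega
  -- the Hasse derivative `g` of order `j`, of degree `m` and leading coefficient `n.choose j`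
  set g : F[X] := hasseDeriv j f with hg
  have hgdeg : g.natDegree = m := by rw [hg, natDegree_hasseDeriv, ← hn, hnj]
  have hglead : g.leadingCoeff = (n.choose j : F) := by
    rw [leadingCoeff, hgdeg, hg, hasseDeriv_coeff, hmj]
    have : f.coeff n = 1 := hfmonic.coeff_natDegree
    rw [this, mul_one]
  have hchoose0 : n.choose j ≠ 0 := (Nat.choose_pos hjn).ne'
  have hg0 : g ≠ 0 := by
    intro h0; rw [h0, natDegree_zero] at hgdeg; omega
  -- base change to `L = F̄` and Taylor expansion at `α`
  set fL : (NormedAlgClosure F)[X] := f.map (algebraMap F (NormedAlgClosure F)) with hfL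
  set gL : (NormedAlgClosure F)[X] := g.map (algebraMap F (NormedAlgClosure F)) with hgL
  set q : (NormedAlgClosure F)[X] := taylor α gL with hq
  have hqdeg : q.natDegree = m := by rw [hq, natDegree_taylor, hgL, natDegree_map, hgdeg]
  have hqlead : q.leadingCoeff = (n.choose j : NormedAlgClosure F) := by
    rw [hq, leadingCoeff_taylor, hgL, leadingCoeff_map, hglead, map_natCast]
  have hq0coeff : q.coeff 0 = (taylor α fL).coeff j := by
    rw [hq, taylor_coeff_zero, hgL, hg, ← hasseDeriv_map, ← taylor_coeff]
  -- `taylor α fL = ∏ (X - C (r - α))` over the roots `r` of `fL`, all of the form `σ • α`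
  have hfLmonic : fL.Monic := hfmonic.map _
  have hfLspl : fL.Splits := IsAlgClosed.splits fL
  have hcard : Multiset.card fL.roots = n := by
    rw [← hfLspl.natDegree_eq_card_roots, hfL, natDegree_map]
  have htaylor : taylor α fL = ((fL.roots.map fun r => r - α).map fun δ => X - C δ).prod := by
    conv_lhs => rw [hfLspl.eq_prod_roots_of_monic hfLmonic]
    rw [taylor_apply, multiset_prod_comp, Multiset.map_map, Multiset.map_map]
    congr 1
    refine Multiset.map_congr rfl fun r _ => ?_
    simp only [Function.comp_apply, sub_comp, X_comp, C_comp, map_sub]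
    ring
  have hroots : ∀ δ ∈ fL.roots.map fun r => r - α, ‖δ‖ ≤ D := by
    intro δ hδ
    obtain ⟨r, hr, rfl⟩ := Multiset.mem_map.mp hδ
    obtain ⟨σ, rfl⟩ := exists_smul_eq_of_mem_aroots α r (by rwa [aroots_def, ← hfL])
    exact hα σ
  have hcoeff : ‖q.coeff 0‖ ≤ D ^ m := by
    rw [hq0coeff, htaylor]
    have := norm_coeff_prod_X_sub_C_le (fL.roots.map fun r => r - α) hD hroots j
    rwa [Multiset.card_map, hcard, hnj] at this
  -- a small root `γ` of `q`; `β := γ + α`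
  obtain ⟨γ, hγroot, hγ⟩ := exists_isRoot_norm_pow_mul_le q (by rw [hqdeg]; omega)
  rw [hqdeg, hqlead] at hγ
  have hpL0 : 0 < ‖(p : NormedAlgClosure F)‖ := norm_pos_iff.mpr (Nat.cast_ne_zero.mpr hp.ne_zero)
  have hchooseL : ‖(p : NormedAlgClosure F)‖ ^ k ≤ ‖(n.choose j : NormedAlgClosure F)‖ :=
    norm_prime_pow_le_norm_natCast hp hpL hchoose0
      ((Nat.factorization_choose_le_log).trans hk)
  -- `‖γ‖ ≤ D * ‖p‖ ^ (-k/m)`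
  set t : ℝ := ‖(p : NormedAlgClosure F)‖ with ht
  set A : ℝ := D * t ^ (-((k : ℝ) / m)) with hA
  have hA0 : 0 ≤ A := mul_nonneg hD (Real.rpow_nonneg hpL0.le _)
  have hm0 : (m : ℝ) ≠ 0 := by exact_mod_cast (show m ≠ 0 by omega)
  have hApow : A ^ m = D ^ m * t ^ (-(k : ℝ)) := by
    rw [hA, mul_pow, ← Real.rpow_natCast (t ^ _) m, ← Real.rpow_mul hpL0.le]
    congr 2
    field_simp
  have hγm : ‖γ‖ ^ m ≤ A ^ m := by
    rw [hApow]
    have h1 : ‖γ‖ ^ m * t ^ k ≤ D ^ m :=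
      (mul_le_mul_of_nonneg_left hchooseL (pow_nonneg (norm_nonneg _) _)).trans (hγ.trans hcoeff)
    have htk : 0 < t ^ k := pow_pos hpL0 k
    rw [Real.rpow_neg hpL0.le, Real.rpow_natCast, ← div_eq_mul_inv, le_div_iff₀ htk]
    exact h1
  have hγA : ‖γ‖ ≤ A := (pow_le_pow_iff_left₀ (norm_nonneg _) hA0 (by omega)).mp hγm
  refine ⟨γ + α, ?_, by rwa [add_sub_cancel_right]⟩
  -- degree of `β = γ + α` over `F` is at most `deg g = m`
  have hroot : aeval (γ + α) g = 0 := by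
    have := hγroot
    rw [IsRoot.def, hq, taylor_eval, hgL, eval_map_algebraMap] at this
    exact this
  have hdeg := minpoly.degree_le_of_ne_zero F (γ + α) hg0 hroot
  calc (minpoly F (γ + α)).natDegree ≤ g.natDegree := natDegree_le_natDegree hdeg
    _ = m := hgdeg

/-- **Ax's exponent** `c_p(k) = Σ_{i=1}^{k} i / p^{i-1}` (so `c_p(0) = 0`,
`c_p(k+1) = c_p(k) + (k+1)/p^k`): the exponent of `‖p‖⁻¹` in our form of Ax's lemma for elements
of degree `< p^{k+1}`. [cite: Ax1970, the Lemma on Δ(α)] -/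
def axExponent (p k : ℕ) : ℝ := ∑ i ∈ Finset.range k, ((i : ℝ) + 1) / (p : ℝ) ^ i

omit [CharZero F] in
/-- `c_p(0) = 0`. [folklore] -/
theorem axExponent_zero (p : ℕ) : axExponent p 0 = 0 := by simp [axExponent]

omit [CharZero F] in
/-- `c_p(k+1) = c_p(k) + (k+1)/p^k`. [folklore] -/
theorem axExponent_succ (p k : ℕ) :
    axExponent p (k + 1) = axExponent p k + ((k : ℝ) + 1) / (p : ℝ) ^ k := by
  simp [axExponent, Finset.sum_range_succ]

omit [CharZero F] in
/-- `c_p(k) ≥ 0`. [folklore] -/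
theorem axExponent_nonneg (p k : ℕ) : 0 ≤ axExponent p k :=
  Finset.sum_nonneg fun i _ => by positivity

omit [CharZero F] in
/-- `c_p` is monotone. [folklore] -/
theorem axExponent_mono (p : ℕ) : Monotone (axExponent p) := by
  refine monotone_nat_of_le_succ fun k => ?_
  rw [axExponent_succ]
  have : 0 ≤ ((k : ℝ) + 1) / (p : ℝ) ^ k := by positivity
  linarith

omit [CharZero F] in
/-- **Uniform bound** `c_p(k) ≤ (p/(p-1))²` for `p ≥ 2` (from `Σ_{i ≥ 0} (i+1) x^i = 1/(1-x)²`,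
`x = 1/p`). [folklore] -/
theorem axExponent_le {p : ℕ} (hp : 2 ≤ p) (k : ℕ) :
    axExponent p k ≤ ((p : ℝ) / (p - 1)) ^ 2 := by
  have hp0 : (0 : ℝ) < p := by exact_mod_cast (show 0 < p by omega)
  have hp1 : (1 : ℝ) < p := by exact_mod_cast (show 1 < p by omega)
  set x : ℝ := (p : ℝ)⁻¹ with hx
  have hx0 : 0 < x := inv_pos.mpr hp0
  have hx1 : x < 1 := inv_lt_one_of_one_lt₀ hp1
  have hxn : ‖x‖ < 1 := by rwa [Real.norm_of_nonneg hx0.le]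
  -- `Σ n x^n · n = x/(1-x)²`, so `Σ (i+1) x^i = 1/(1-x)²`
  have hsum : HasSum (fun n : ℕ => (n : ℝ) * x ^ n) (x / (1 - x) ^ 2) :=
    hasSum_coe_mul_geometric_of_norm_lt_one hxn
  have hle : ∑ i ∈ Finset.range (k + 1), (i : ℝ) * x ^ i ≤ x / (1 - x) ^ 2 :=
    sum_le_hasSum (Finset.range (k + 1)) (fun n _ => by positivity) hsum
  have hshift : ∑ i ∈ Finset.range (k + 1), (i : ℝ) * x ^ i = x * axExponent p k := by
    rw [Finset.sum_range_succ', axExponent, Finset.mul_sum]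
    simp only [Nat.cast_zero, zero_mul, add_zero, Nat.cast_succ, pow_succ]
    refine Finset.sum_congr rfl fun i _ => ?_
    rw [hx, inv_pow]
    field_simp
  rw [hshift] at hle
  have h1x : (1 - x) ^ 2 ≠ 0 := by positivity
  have hkey : axExponent p k ≤ 1 / (1 - x) ^ 2 := by
    have := div_le_div_of_nonneg_right hle hx0.le
    rwa [mul_div_cancel_left₀ _ hx0.ne', div_div, mul_comm, ← div_div, div_self hx0.ne'] at this
  calc axExponent p k ≤ 1 / (1 - x) ^ 2 := hkey
    _ = ((p : ℝ) / (p - 1)) ^ 2 := by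
      rw [hx]
      field_simp

/-- **Ax's lemma, band form**: if `deg_F α < p^{k+1}` and `‖σ α - α‖ ≤ D` for all `σ ∈ Γ_F`,
then `‖α - a‖ ≤ ‖p‖^{-c_p(k)} D` for some `a ∈ F`. Induction on `k` using `ax_step` with
`m = p^{k-1}` (and `m = 1` in the band `k = 0`, where the derivative of order `n-1` is linear).
[cite: Ax1970, the Lemma on Δ(α)] [cite: FontaineOuyang2022, §3.1 (Ax–Sen's lemma)] -/
theorem ax_band {p : ℕ} (hp : p.Prime) (hpL : ‖(p : NormedAlgClosure F)‖ < 1) (k : ℕ) :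
    ∀ (α : NormedAlgClosure F), (minpoly F α).natDegree < p ^ (k + 1) →
      ∀ {D : ℝ}, 0 ≤ D → (∀ σ : absoluteGaloisGroup F, ‖σ • α - α‖ ≤ D) →
        ∃ a : F, ‖α - algebraMap F (NormedAlgClosure F) a‖ ≤
          ‖(p : NormedAlgClosure F)‖ ^ (-axExponent p k) * D := by
  have hpL0 : 0 < ‖(p : NormedAlgClosure F)‖ := norm_pos_iff.mpr (Nat.cast_ne_zero.mpr hp.ne_zero)
  have hone : ∀ e : ℝ, 0 ≤ e → 1 ≤ ‖(p : NormedAlgClosure F)‖ ^ (-e) := fun e he =>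
    Real.one_le_rpow_of_pos_of_le_one_of_nonpos hpL0 hpL.le (neg_nonpos.mpr he)
  -- degree-`≤ 1` elements are in `F`
  have hdeg1 : ∀ β : NormedAlgClosure F, (minpoly F β).natDegree ≤ 1 → ∃ a : F, algebraMap F (NormedAlgClosure F) a = β := by
    intro β hβ
    have hint : IsIntegral F β := Algebra.IsIntegral.isIntegral β
    have hpos := minpoly.natDegree_pos hint
    have h1 : (minpoly F β).natDegree = 1 := le_antisymm hβ hpos
    have : β ∈ (algebraMap F (NormedAlgClosure F)).range := by
      rw [← minpoly.natDegree_eq_one_iff]; exact h1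
    exact this
  induction k with
  | zero =>
    intro α hn D hD hα
    rw [axExponent_zero, neg_zero, Real.rpow_zero, one_mul]
    rw [zero_add, pow_one] at hn
    have hint : IsIntegral F α := Algebra.IsIntegral.isIntegral α
    rcases Nat.lt_or_ge 1 (minpoly F α).natDegree with hlt | hle
    · -- degree `n ≥ 2`, `n < p`: one step with `m = 1`, loss exponent `log_p n = 0`
      have hlog : Nat.log p (minpoly F α).natDegree ≤ 0 :=
        (Nat.log_eq_zero_iff.mpr (Or.inl hn)).le
      obtain ⟨β, hβdeg, hβ⟩ := ax_step hp hpL α hD hα le_rfl hlt hlog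
      rw [Nat.cast_zero, zero_div, neg_zero, Real.rpow_zero, mul_one] at hβ
      obtain ⟨a, rfl⟩ := hdeg1 β hβdeg
      exact ⟨a, by rwa [norm_sub_rev]⟩
    · obtain ⟨a, rfl⟩ := hdeg1 α hle
      exact ⟨a, by rw [sub_self, norm_zero]; exact hD⟩
  | succ k ih =>
    intro α hn D hD hα
    rcases Nat.lt_or_ge (minpoly F α).natDegree (p ^ (k + 1)) with hlt | hge
    · -- already in the lower band
      obtain ⟨a, ha⟩ := ih α hlt hD hα
      refine ⟨a, ha.trans (mul_le_mul_of_nonneg_right ?_ hD)⟩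
      exact Real.rpow_le_rpow_of_exponent_ge hpL0 hpL.le
        (neg_le_neg (axExponent_mono p (Nat.le_succ k)))
    · -- band `k+1`: step down to degree `≤ p^k` with loss exponent `(k+1)/p^k`
      have hintα : IsIntegral F α := Algebra.IsIntegral.isIntegral α
      have hlog : Nat.log p (minpoly F α).natDegree ≤ k + 1 :=
        Nat.lt_succ_iff.mp (Nat.log_lt_of_lt_pow (minpoly.natDegree_pos hintα).ne' hn)
      have hm1 : 1 ≤ p ^ k := Nat.one_le_pow _ _ hp.pos
      have hmn : p ^ k < (minpoly F α).natDegree :=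
        lt_of_lt_of_le (Nat.pow_lt_pow_right hp.one_lt (Nat.lt_succ_self k)) hge
      obtain ⟨β, hβdeg, hβ⟩ := ax_step hp hpL α hD hα hm1 hmn hlog
      set e : ℝ := ((k : ℝ) + 1) / (p : ℝ) ^ k with he
      have hecast : ((k + 1 : ℕ) : ℝ) / ((p ^ k : ℕ) : ℝ) = e := by
        rw [he]; push_cast; ring
      rw [hecast] at hβ
      have he0 : 0 ≤ e := by positivity
      set D' : ℝ := D * ‖(p : NormedAlgClosure F)‖ ^ (-e) with hD'
      have hDD' : D ≤ D' := le_mul_of_one_le_right hD (hone e he0)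
      have hD'0 : 0 ≤ D' := hD.trans hDD'
      have hβ' : ∀ τ : absoluteGaloisGroup F, ‖τ • β - β‖ ≤ D' :=
        norm_smul_sub_le_of_near hα hβ hDD'
      have hβlt : (minpoly F β).natDegree < p ^ (k + 1) :=
        lt_of_le_of_lt hβdeg (Nat.pow_lt_pow_right hp.one_lt (Nat.lt_succ_self k))
      obtain ⟨a, ha⟩ := ih β hβlt hD'0 hβ'
      refine ⟨a, ?_⟩
      have hαa : α - algebraMap F (NormedAlgClosure F) a = (α - β) + (β - algebraMap F (NormedAlgClosure F) a) := by abel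
      rw [hαa]
      refine (IsUltrametricDist.norm_add_le_max _ _).trans (max_le ?_ ?_)
      · rw [norm_sub_rev]
        refine hβ.trans ?_
        calc D' ≤ ‖(p : NormedAlgClosure F)‖ ^ (-axExponent p k) * D' :=
              le_mul_of_one_le_left hD'0 (hone _ (axExponent_nonneg p k))
          _ = ‖(p : NormedAlgClosure F)‖ ^ (-axExponent p (k + 1)) * D := by
              rw [hD', axExponent_succ, ← he, neg_add, Real.rpow_add hpL0]; ring
      · refine ha.trans (le_of_eq ?_)
        rw [hD', axExponent_succ, ← he, neg_add, Real.rpow_add hpL0]; ring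

/-- **Ax's lemma** (Ax 1970; Fontaine–Ouyang §3.1 "Ax–Sen's lemma"), our form: for a
characteristic-`0` non-archimedean local field `F` of residue characteristic `p` and `α ∈ F̄` with
`‖σ α - α‖ ≤ D` for all `σ ∈ Γ_F`, there is `a ∈ F` with `‖α - a‖ ≤ ‖p‖^{-c} · D`, where
`c = c_p(log_p deg_F α) ≤ (p/(p-1))²` (`axExponent`; Ax's constant is the sharper `p/(p-1)²`).
[cite: Ax1970, the Lemma on Δ(α)] [cite: FontaineOuyang2022, §3.1 (Ax–Sen's lemma)] -/
theorem ax_lemma {p : ℕ} (hp : p.Prime) (hpL : ‖(p : NormedAlgClosure F)‖ < 1)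
    (α : NormedAlgClosure F) {D : ℝ} (hD : 0 ≤ D)
    (hα : ∀ σ : absoluteGaloisGroup F, ‖σ • α - α‖ ≤ D) :
    ∃ a : F, ‖α - algebraMap F (NormedAlgClosure F) a‖ ≤
      ‖(p : NormedAlgClosure F)‖ ^ (-axExponent p (Nat.log p (minpoly F α).natDegree)) * D :=
  ax_band hp hpL _ α (Nat.lt_pow_succ_log_self hp.one_lt _) hD hα

/-- **Ax's lemma with a uniform constant**: `‖α - a‖ ≤ ‖p‖^{-(p/(p-1))²} · D` for some `a ∈ F`.
[cite: Ax1970, the Lemma on Δ(α)] [cite: FontaineOuyang2022, §3.1 (Ax–Sen's lemma)] -/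
theorem ax_lemma' {p : ℕ} (hp : p.Prime) (hpL : ‖(p : NormedAlgClosure F)‖ < 1)
    (α : NormedAlgClosure F) {D : ℝ} (hD : 0 ≤ D)
    (hα : ∀ σ : absoluteGaloisGroup F, ‖σ • α - α‖ ≤ D) :
    ∃ a : F, ‖α - algebraMap F (NormedAlgClosure F) a‖ ≤
      ‖(p : NormedAlgClosure F)‖ ^ (-(((p : ℝ) / (p - 1)) ^ 2)) * D := by
  obtain ⟨a, ha⟩ := ax_lemma hp hpL α hD hα
  have hpL0 : 0 < ‖(p : NormedAlgClosure F)‖ :=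
    norm_pos_iff.mpr (Nat.cast_ne_zero.mpr hp.ne_zero)
  refine ⟨a, ha.trans (mul_le_mul_of_nonneg_right ?_ hD)⟩
  exact Real.rpow_le_rpow_of_exponent_ge hpL0 hpL.le (neg_le_neg (axExponent_le hp.two_le _))

end NormedAlgClosure

/-! ### The residue characteristic -/

/-- A non-archimedean local field has a (unique) prime `p` — its residue characteristic — with
`|p|_F < 1`. [folklore] -/
theorem exists_prime_valuation_lt_one : ∃ p : ℕ, p.Prime ∧ valuation F (p : F) < 1 := by
  haveI : CharP 𝓀[F] (ringChar 𝓀[F]) := ringChar.charP 𝓀[F]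
  refine ⟨ringChar 𝓀[F], CharP.prime_ringChar 𝓀[F], ?_⟩
  have h0 : IsLocalRing.residue 𝒪[F] (ringChar 𝓀[F] : 𝒪[F]) = 0 := by
    rw [map_natCast]; exact CharP.cast_eq_zero 𝓀[F] _
  have hmem : ((ringChar 𝓀[F] : ℕ) : 𝒪[F]) ∈ 𝓂[F] := (IsLocalRing.residue_eq_zero_iff _).mp h0
  have h := (normAbs_lt_one_iff (F := F)).mp (normAbs_lt_one_iff_mem_maximalIdeal.mpr hmem)
  simpa using h

/-! ### The Ax–Sen–Tate theorem -/

namespace CompletedAlgClosure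

variable [CharZero F]

/-- **Ax–Sen–Tate, the inclusion `ℂ_F^{Γ_F} ⊆ F`** (Tate 1967 §3.3 Thm. 1; Ax 1970): an element of
`ℂ_F` fixed by `Γ_F` lies in (the closed image of) `F`. [cite: Tate1967, §3.3 Theorem 1]
[cite: Ax1970, main Theorem] [cite: FontaineOuyang2022, §3.1 (Ax–Sen's lemma)] -/
theorem fixedPoints_subset_range_algebraMap :
    {x : CompletedAlgClosure F | ∀ σ : absoluteGaloisGroup F, σ • x = x} ⊆
      Set.range (algebraMap F (CompletedAlgClosure F)) := by
  intro x hx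
  obtain ⟨p, hp, hpv⟩ := exists_prime_valuation_lt_one (F := F)
  have hpL : ‖(p : NormedAlgClosure F)‖ < 1 := by
    rw [← map_natCast (algebraMap F (NormedAlgClosure F)), NormedAlgClosure.norm_algebraMap]
    exact (norm_lt_one_iff F _).mpr hpv
  set M : ℝ := ‖(p : NormedAlgClosure F)‖ ^ (-(((p : ℝ) / (p - 1)) ^ 2)) with hM
  have hM0 : 0 ≤ M := Real.rpow_nonneg (norm_nonneg _) _
  rw [← (isClosed_range_algebraMap (F := F)).closure_eq, Metric.mem_closure_iff]
  intro ε hε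
  have hM1 : 0 < M + 1 := by linarith
  obtain ⟨α, hα⟩ := (denseRange_coe (F := F)).exists_dist_lt x (div_pos hε hM1)
  rw [dist_eq_norm] at hα
  set d : ℝ := ‖x - (α : CompletedAlgClosure F)‖ with hd
  have hdev : ∀ σ : absoluteGaloisGroup F, ‖σ • α - α‖ ≤ d := by
    intro σ
    rw [← Completion.norm_coe, Completion.coe_sub, ← smul_coe]
    have h : σ • (α : CompletedAlgClosure F) - α = σ • ((α : CompletedAlgClosure F) - x) + (x - α) := by
      rw [smul_sub, hx σ]; abel
    rw [h]
    refine (IsUltrametricDist.norm_add_le_max _ _).trans (max_le ?_ le_rfl)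
    rw [norm_smul, norm_sub_rev]
  obtain ⟨a, ha⟩ := NormedAlgClosure.ax_lemma' hp hpL α (norm_nonneg _) hdev
  refine ⟨algebraMap F _ a, ⟨a, rfl⟩, ?_⟩
  rw [dist_eq_norm]
  have hsplit : x - algebraMap F (CompletedAlgClosure F) a =
      (x - α) + ((α : CompletedAlgClosure F) - algebraMap F _ a) := by abel
  rw [hsplit]
  refine (IsUltrametricDist.norm_add_le_max _ _).trans_lt (max_lt ?_ ?_)
  · calc d < ε / (M + 1) := hα
      _ ≤ ε := div_le_self hε.le (by linarith)
  · rw [algebraMap_eq_coe, ← Completion.coe_sub, Completion.norm_coe]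
    calc ‖α - algebraMap F (NormedAlgClosure F) a‖ ≤ M * d := ha
      _ ≤ (M + 1) * d := mul_le_mul_of_nonneg_right (by linarith) (norm_nonneg _)
      _ < (M + 1) * (ε / (M + 1)) := mul_lt_mul_of_pos_left hα hM1
      _ = ε := mul_div_cancel₀ ε hM1.ne'

/-- **The Ax–Sen–Tate theorem** (Tate 1967, §3.3 Thm. 1: `H⁰(G, C) = K`; Ax 1970, main Theorem;
Fontaine–Ouyang §3.1): for a non-archimedean local field `F` of characteristic `0`, the elements of
`ℂ_F = \widehat{F̄}` fixed by `Γ_F = Gal(F̄/F)` are exactly (the image of) `F`: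
`ℂ_F^{Γ_F} = F`. This is the shape of `PeriodRingData.invariants_eq` and its degree-`0` instance
for `B_HT = ⊕ ℂ_F(i)`. [cite: Tate1967, §3.3 Theorem 1] [cite: Ax1970, main Theorem]
[cite: FontaineOuyang2022, §3.1 (C^{G_K} = K)] -/
theorem fixedPoints_eq_range_algebraMap :
    {x : CompletedAlgClosure F | ∀ σ : absoluteGaloisGroup F, σ • x = x} =
      Set.range (algebraMap F (CompletedAlgClosure F)) :=
  Set.Subset.antisymm fixedPoints_subset_range_algebraMap range_algebraMap_subset_fixedPoints

end CompletedAlgClosure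

end Ax

end Literature.NumberTheory.PAdicHodge

end
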